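import Mathlib
import HarnessLib
import HarnessLib.Audit
import Summits.AtomisticToContinuum.Statement
import Literature.MathematicalPhysics.StatisticalMechanics.HaggStacking
import Literature.MathematicalPhysics.StatisticalMechanics.BarlowStacking
import Literature.MathematicalPhysics.StatisticalMechanics.BarlowStackingEnergy
import Summits.AtomisticToContinuum.Crystallization.Theorems.ExcessDecayLiouvilleCrysEnergyLimit
import Summits.AtomisticToContinuum.Crystallization.Theorems.PricedLinkCensusStackingHingeBarlowEnergyIdentification

/-!
Route: KarpPeierlsStackingLock

CLOSED (retired) 2026-08-15T13:43:29Z by operator:999:1257524 — reason: not-a-thesis: assembly does not conclude the sub-problem Statement — note: D-0027 §2.1 audit (human 2026-08-15: routes that do not decide the summit are removed): the assembly concludes `Literature.MathematicalPhysics.StatisticalMechanics.Crystallization`, not the sub-problem statement; a NEW conforming route may be opened from the same idea (generated `closes : … → _root_. The file is kept as the record of this route; refuted decls are indexed as negative knowledge (`ledger negatives`).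

# Route KarpPeierlsStackingLock — stacking selection as a locked phase — min-mean-cycle dual
certificate + Peierls gap against the summable registry tail

X = X_lock ∧ X_red ("it suffices to show"), realising card karp-peierls-stacking-lock. X_lock
(LOCKED STACKING ON THE BOX): for every
in-layer spacing a ∈ [47/50, 1] and layer spacing h ∈ [0.78a, 0.85a] (the box B of route
PoissonBesselStacking, shared on purpose; it contains the relaxed
LJ values a* ≈ 0.9712, h* ≈ 0.7930, r₀ = 1 units) the Lennard-Jones interlayer registry couplings
J_k(a,h) = barlowCoupling lennardJones a h k have
Σ k|J_k| < ∞ and the stacking energy density haggStackingEnergy J over ALL Hägg sequences is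
minimised by a PERIODIC one. X_lock is
reached in two layers: the general PEIERLS–KARP STABILITY LEMMA (a finite min-mean-cycle dual
certificate at window length K — optimal
edge set E of the de Bruijn graph, node potentials u, value λ, gap g — with g ≥
2Σ_{k>K}(k+|E|+1)|J_k| forces a periodic minimiser of
the infinite-range chain) plus the CERTIFIED EXISTENCE of such a certificate for J(a,h) uniformly on
B (expected witness K = 2,
E = {+−, −+}, u ≡ 0, λ = J₂, g = −J₂: Hägg domination). X_red (PERIODIC REDUCTION TO BARLOW, shared
item 3062 of PoissonBesselStacking): every periodic
configuration of ℝ³ is energetically matched or beaten by a uniform Barlow stacking with (a,h) ∈ B.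
X_lock ∧ X_red ∧ (layer bookkeeping +
compactness of B: LockedBoxMinimiser) give the attained periodic minimum (0627); with the
thermodynamic-limit bookkeeping (0626) and the positional conjunct (0625, shared crux) the
sub-problem follows.
Lean: `LockedStackingOnBox ∧ PeriodicReductionToBarlow`

## Assembly
Pure logic given the items (checked sorry-free in Sketch.lean: `fun hM hL hR hI hP hE hC =>
crystallization_of_isLeast_tendsto_isCrystallizing
⟨hM hL hR hI hP, hE, hC⟩`): LockedBoxMinimiser turns the locked chain + the reduction + the two
bookkeeping lemmas into the attained
periodic minimum (0627); IsLeast.csInf_eq turns CrysEnergyLimit into the Tendsto clause of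
HasPeriodicGroundStateEnergy; CrysPositional is
conjunct (ii).

Rationale: WHY THIS LINE. Stacking selection for Lennard-Jones is a zero-temperature ERGODIC OPTIMISATION
problem on the 3-letter Hägg shift with summable
(indeed exponentially small, Lennard-Jones–Dent/Poisson) registry couplings; at finite range K its
minimisers are the minimum mean
cycles of a finite de Bruijn graph (Teubner1990, RadinSchulman1983) and LP/Bellman duality hands out
node potentials that turn the
truncated interaction into an equivalent m-potential with a Peierls constant (HolsztynskiSlawny1978;
FriedliVelenik2017 Lemma 7.13);
the new step is the TAIL-STABILITY LEMMA — the gap survives the infinite-range remainder when g ≥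
2Σ_{k>K}(k+|E|+1)|J_k| — which makes
"is the LJ stacking periodic?" a terminating finite certificate whenever LJ sits in the interior of
a locking plateau, the generic
situation for couplings decaying faster than k⁻³ (GlodkowskiMiekisz2024,
VanenterKoivusaloMiekisz2019, Contreras2015). Imported
areas: ergodic optimisation / symbolic dynamics (min-mean-cycle, sub-actions), Pirogov–Sinai
ground-state theory (m-potentials,
Peierls condition), certified computation (interval lattice sums). Prior routes use only the hand
inequality |J₂| > Σ(k−1)|J_k|
(support items 0716/0737, K = 2, u ≡ 0) inside theses about local rigidity; this line makes the
certificate format, its gap and its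
quantitative defect bound (LockedPhaseDefectBound, the input fault-counting items such as 0759 need)
the spine, and is potential-
agnostic: if the numerics J₂ ≈ −7.3e−5 were overturned, K = 3, 4 certify whichever polytype wins.
The hard 3-D reduction (3062), the layer identification (3065), 0626 and 0625 are SHARED items
(identical signatures) —
this route adds exactly the certificate lemma, its LJ instance, the quantitative defect bound and
the compactness glue. Negatives index empty at filing.

RANKED CRUXES. #0 LockedStackingOnBox (target) — for all (a,h) in the box B: Σ_k k|J_k(a,h)| < ∞ for
J = barlowCoupling lennardJones a h, and some periodic Hägg sequence w minimises haggStackingEnergy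
J over all Hägg sequences (X_lock; = PeierlsKarpStability + LJLockingCertificate via the glue
CertificateLocks, or directly Hägg domination 0737 + certified J₂). (why it might fail: False iff at
some (a,h) ∈ B the LJ registry chain has no periodic minimiser (aperiodic/Sturmian selection): needs
a codimension-≥1 coincidence for couplings decaying faster than k⁻³, but J_k are uncertified.)
[GlodkowskiMiekisz2024, VanenterKoivusaloMiekisz2019, PartayOrtnerCsanyi2017, LoachAckland2017]
#2 PeriodicReductionToBarlow (crux) — X_red (shared item 3062 of route PoissonBesselStacking,
identical signature): for every periodic configuration Q of ℝ³ (any full-rank lattice, any finite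
motif) there are (a,h) ∈ B and a p-periodic Hägg sequence s such that the UNIFORM Barlow stacking
barlowPeriodicConfiguration s at (a,h) has LJ energy per particle ≤ that of Q. The genuinely 3-D
content (local optimality of close packing, 0672 / CrystalLocalRigidity (a)); this route consumes
it, it does not attack it. [difficulty: open-problem] (why it might fail: Contains local optimality
of close packing among ALL lattice+motif configurations (open, BlancLewin2015 §2.3); uniform
spacings lose to layer-wise relaxed polytypes unless hcp's margin ≈|J₂|/2 per layer beats relaxation
gains (≈1e−8); optimum might leave B.) [BlancLewin2015, FlatleyTheil2015, BeterminSamajTravenec2022,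
Stillinger2001, PartayOrtnerCsanyi2017, stmt-AtomisticToContinuum-3062]
#3 LJLockingCertificate (crux) — CERTIFIED LOCKING CERTIFICATE for Lennard-Jones on the box: there
are a window length K = L+1 and a set E of Hägg K-words forming node-disjoint simple cycles of the
de Bruijn graph (out/in-degree ≤ 1 on E, every E-word continues in E) such that for every (a,h) ∈ B,
with J = barlowCoupling lennardJones a h: Σ k|J_k| < ∞ and there are node potentials u on
(K−1)-words, a value λ and a gap g with slack(x) := Σ_{k=2}^{K} J_k·1[x₀+…+x_{k−1} ≡ 0 (3)] − λ +
u(prefix x) − u(suffix x) = 0 on E, ≥ g on every other Hägg K-word, and g ≥ 2Σ_{k>K}(k+|E|+1)|J_k|.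
Expected witness (card S3, Hägg domination): L = 1, E = {(+,−),(−,+)}, u ≡ 0, λ = J₂ < 0, g = −J₂ ≈
7e−5 against a tail ≈ 1e−6 (ratio 250–600); certified by interval arithmetic for the 2-D layer sums
(Poisson/Bessel form converges exponentially) with a rigorous tail bound, uniformly on B.
[difficulty: L] (why it might fail: Needs interval-certified 2-D lattice sums J_k(a,h) uniformly on
B plus a tail bound (no such infrastructure in tree); fails if J₂ changes sign on B or no finite K
locks (Hubbard-type aperiodic selection); K=2 witness rests on uncertified J₂≈−7.3e-5.)
[PartayOrtnerCsanyi2017, LoachAckland2017, Stillinger2001, stmt-AtomisticToContinuum-0670,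
Literature.Barriers.AtomisticToContinuum.Hubbard1978_mostHomogeneous]
#4 PeierlsKarpStability (crux) — PEIERLS–KARP STABILITY LEMMA (card S1; pure 1-D lattice-gas theorem
over HaggStacking.lean, no LJ input): for couplings J with Σ k|J_k| < ∞, a window length K = L+1, a
nonempty set E of Hägg K-words with out-degree ≤ 1, in-degree ≤ 1 and continuation inside E (so E is
a disjoint union of simple cycles with pairwise distinct (K−1)-nodes), potentials u, value λ and gap
g such that the slack Σ_{k=2}^{K} J_k 1[x₀+…+x_{k−1} ≡ 0 (3)] − λ + u(prefix x) − u(suffix x)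
vanishes on E and is ≥ g on every other Hägg K-word, and g ≥ 2·Σ_{k>K}(k+|E|+1)|J_k|: SOME periodic
sequence w all of whose K-windows lie in E (an E-cycle read off letter by letter) minimises
haggStackingEnergy J over all Hägg sequences. Proof sketch: telescoping the potentials gives
H_n^K(s) ≥ nλ − osc(u) + g·b_n (b_n = # bad windows in [0,n)); good stretches follow E-cycles by the
degree conditions; the tail k > K differs from the cycles' tail densities by ≤
(b_n+1)Σ_{k>K}(k+|E|+1)|J_k|; choose the E-cycle of least full density. K = 2, E = {+−,−+}, u ≡ 0 is
Hägg domination (0737) with a cruder constant. [difficulty: M] (why it might fail: Only by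
bookkeeping: the tail constant 2Σ_{k>K}(k+|E|+1)|J_k|, windows poking beyond n, liminf junk values,
or a missing structural clause on E; brute force (K≤3: hcp, dhcp, fcc locks; periods ≤10;
near-threshold tails) found 0 violations.) [RadinSchulman1983, Teubner1990, HolsztynskiSlawny1978,
FriedliVelenik2017, GlodkowskiMiekisz2024, stmt-AtomisticToContinuum-0737]
#5 CrysPositional (crux) — the positional conjunct IsCrystallizing lennardJones 3 itself (shared
item 0625 of CrystalLocalRigidity; this route contributes to it only the registry gap —
LockedPhaseDefectBound ⇒ O(N^{2/3}/g) misaligned layers, the input of fault-counting items such as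
0759 — not the layering/rigidity). [difficulty: open-problem] (why it might fail: Conjunct (ii)
itself: rigidity for a PAIR potential in 3-D without Flatley–Theil's three-body term is open;
persistent polytetrahedral/icosahedral order in LJ ground states would refute it and every stacking
route with it.) [BlancLewin2015, FlatleyTheil2015, Theil2006, stmt-AtomisticToContinuum-0625]
#9 CertificateLocks (support) — glue of the target: the stability lemma instantiated with the LJ
certificate gives LockedStackingOnBox (pure instantiation; E-words are Hägg words, so the E-periodic
minimiser is a Hägg sequence). [difficulty: provable-now] [RadinSchulman1983]
#9 BarlowEnergyIdentification (support) — layer bookkeeping (shared item 3065 of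
PoissonBesselStacking, identical signature; the identification left open in
BarlowStackingEnergy.lean): for a, h > 0 and a p-periodic Hägg sequence s, the energy per particle
of barlowPeriodicConfiguration s for Lennard-Jones equals barlowBaseEnergy lennardJones a h +
haggEnergy p (barlowCoupling lennardJones a h) s / p (regroup the absolutely convergent point-set
sum by layers: barlowPeriodicConfiguration_points, barlowSiteEnergy_average_eq_haggEnergy,
summability from le_dist_barlowPos and the r⁻⁶ tail). [difficulty: M] [BlancLewin2015,
PartayOrtnerCsanyi2017, stmt-AtomisticToContinuum-3065]
#9 HaggEnergyPeriodic (support) — for summable J and a p-periodic sequence s (p > 0) the stacking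
energy density haggStackingEnergy J s (a liminf of H_n/n) equals the per-period average haggEnergy p
J s / p (local energies are p-periodic in the base point, H_{qp+r} = q·H_p + O(p·Σ|J_k|)).
[difficulty: provable-now] [PartayOrtnerCsanyi2017]
#9 CrysEnergyLimit (support) — energetic thermodynamic limit (shared item 0626): E(N)/N → ⨅ over
periodic configurations of the LJ energy per particle (periodisation 0715 + trial blocks 0629 +
stability 0713; bookkeeping, not this route's content). [difficulty: L] [BlancLewin2015,
stmt-AtomisticToContinuum-0626]
#9 LockedBoxMinimiser (support) — ANALYSIS GLUE to the attained periodic minimum (0627):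
LockedStackingOnBox → PeriodicReductionToBarlow → BarlowEnergyIdentification → HaggEnergyPeriodic →
∃ P periodic, IsLeast (range e_LJ) (e P). Proof: φ(a,h) := e₀(a,h) + min_s
haggStackingEnergy(J(a,h), s) is continuous on the compact box B (e₀ and (a,h) ↦ (J_k(a,h))_k ∈ ℓ¹
depend continuously on (a,h) by uniform convergence of the LJ layer sums on B; an infimum of an
equicontinuous affine family is continuous), so it is attained at some (a₀,h₀); P :=
barlowPeriodicConfiguration w_{a₀,h₀}; for any Q the reduction gives a box stacking s_Q at (a,h)
with e(Q) ≥ e(s_Q) = e₀(a,h) + haggStackingEnergy(s_Q) ≥ φ(a,h) ≥ φ(a₀,h₀) = e(P). [difficulty: M]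
[BlancLewin2015, BeterminSamajTravenec2022, stmt-AtomisticToContinuum-0627]
#9 LockedPhaseDefectBound (support) — QUANTITATIVE LOCKING (the Peierls inequality behind the lemma,
for the positional side): under the hypotheses of PeierlsKarpStability there are an E-periodic w and
a constant C such that for every Hägg sequence s and every n: (g − 2Σ_{k>K}(k+|E|+1)|J_k|)·#{m < n :
the K-window of s at m is not in E} ≤ haggEnergy n J s − n·haggStackingEnergy J w + C (C = tail +
osc(u)). Hence a stacking whose registry energy exceeds the minimum by Δ carries ≤ (Δ + C)/(g −
2·tail) misaligned windows — the per-fault price that fault-counting statements (0759) assume.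
[difficulty: M] [HolsztynskiSlawny1978, FriedliVelenik2017, stmt-AtomisticToContinuum-0759]

TWO-LAYER PLAN. LockedStackingOnBox ⇐ PeierlsKarpStability → LJLockingCertificate →
LockedStackingOnBox (glue CertificateLocks, filed as support now).
Foreseen once LJLockingCertificate moves: LJLockingCertificate ⇐ CertifiedCouplingBox (interval
enclosures of J_2..J_K and ∂/∂(a,h) on B) →
RegistryTailBound (Σ_{k>K}(k+|E|+1) sup_B|J_k| ≤ explicit, from the Bessel/Poisson form) → KarpRun
(finite check of the 2^K slacks) → LJLockingCertificate.
PeriodicReductionToBarlow is owned (and will be split) by route PoissonBesselStacking (foreseen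
there: layering of near-optimal periodic Q →
hole locking of offsets → uniformisation of spacings); this route files no children for it.

KILL CRITERIA. LJLockingCertificate refuted on B for EVERY K (e.g. a proof that the LJ registry
chain has a non-periodic unique ground state, or that
J₂ vanishes inside B with no higher-K lock) closes the route `refuted:LJLockingCertificate` and
revives RefuteCrystalPeriodicMin with the
witness. PeierlsKarpStability refuted = a constant/bookkeeping error: restate (the K = 2 instance
0737 is refuter-verified), no pivot.
PeriodicReductionToBarlow refuted because the optimum lies outside B or needs non-uniform spacings:
restate (with PoissonBesselStacking)
on the corrected box / a layer-relaxed stacking family (pivot, same line); refuted because a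
non-close-packed periodic structure wins:
every stacking-selection route is moot — close. 0627 proved elsewhere (CrystalLocalRigidity (c),
monotone-pairing/poisson-bessel routes) moots the energetic half;
the route then lives only through LockedPhaseDefectBound as supplier of the fault price.

NOT DECOMPOSED YET. The interval-arithmetic format of the coupling box and the tail bound (children
of LJLockingCertificate); the (a,h)-dependence of the
potentials u (taken pointwise in the statement, uniform in practice); layer-wise relaxation and
in-plane distortion (children of
PeriodicReductionToBarlow, owned by PoissonBesselStacking); the uniform-convergence lemmas inside
LockedBoxMinimiser; the fault-counting use of LockedPhaseDefectBound in finite clusters (belongs to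
the positional routes, 0759);
mirror/negation symmetry of optimal cycles (handled inside the lemma by allowing several E-cycles
and choosing the one of least full
density); nothing below layer 2 is filed.

CHEAPEST FALSIFIER. (1) Brute force the typed PeierlsKarpStability / LockedPhaseDefectBound on K ≤
3, |J| random with tails at the threshold, all periodic
competitors of period ≤ 12 and random finite words — done in folder compute/pk_check.py for hcp
(K=2), dhcp and fcc locks (K=3) and
near-threshold tails: 0 violations, minimum slack ≈ the tail constant. (2) Float evaluation of
J₂(a,h), J₃, J₄ at the four corners of B
(direct layer sums, folder compute/jk_corners2.py, DONE): at the corners of B, J₂ = −1.44e−4 (0.94,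
0.733), −4.81e−5 (0.94, 0.799), −1.17e−4 (1, 0.78),
−3.68e−5 (1, 0.85), and −7.26e−5 at (a*,h*); J₃ ∈ [−2.5e−7, −3.1e−8], J₄ ∈ [−4.4e−10, −3.8e−11]; the
lemma's threshold 2Σ_{k≥3}(k+3)|J_k| ∈ [3.8e−7, 3.0e−6],
so the expected K = 2 witness verifies in floats with ratio −J₂/(2·tail) ∈ [47, 98] on all of B
(PoissonBesselStacking's sharper (k−1)-weighted ratio: ≥ 287)
— had J₂ ≥ 0 or ratio < 1 appeared anywhere on B, the witness would be dead. (3) Lookup: Cooper et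
al. 2024/2025 exact Barlow lattice sums (doi:10.1021/acs.jpclett.4c01986)
— "energies of all Barlow packings lie between fcc and hcp except when quasi-degenerate":
consistent.

NUMBERS. a* = (A₁₂/A₆)^{1/6} = 0.9712 (fcc: A₆ = 14.4539, A₁₂ = 12.1319; hcp: 14.4549, 12.1323;
Stillinger2001), ideal h* = a*√(2/3) = 0.7930;
box B = {0.94 ≤ a ≤ 1, 0.78a ≤ h ≤ 0.85a} (shared with PoissonBesselStacking). Card/route numerics:
J₂(a*,h*) ≈ −7.26e−5 (a = 0.9712), −6.42e−5 (a = 1); J₃ ≈ −7.2e−8,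
J₄ ≈ −1e−10 (card luttinger-tisza-registry-lp and folder compute/jk_corners.py, direct layer sums;
corners of B: J₂ ∈ [−1.44e−4, −3.68e−5]); Hägg-domination ratio |J₂|/Σ_{k≥3}k|J_k| ≈ 250 (route
numerics on
0759) to 300–600 (card poisson-bessel-stacking-selection); hcp below fcc by ≈ 1e−4 relative
(Stillinger2001). Items at open: 12
(1 target, 4 cruxes — 2 shared —, 6 support — 2 shared —, 1 assembly).

DEFINITION REQUESTS. None needed to type the items: IsHaggSeq, haggEnergy, haggStackingEnergy
(HaggStacking.lean), barlowCoupling, barlowBaseEnergy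
(BarlowStackingEnergy.lean), barlowPeriodicConfiguration (BarlowStacking.lean),
PeriodicConfiguration.energyPerParticle, lennardJones,
IsCrystallizing, groundStateEnergy, Crystallization (Crystallization.lean) all exist; the
certificate predicate is inlined (a named
`IsKarpCertificate L E u lam g J` abbreviation in
Literature/MathematicalPhysics/StatisticalMechanics would shorten three signatures —
optional, not filed).

Novelty: Searches (2026-08-15): `lit frontier AtomisticToContinuum --since 2020` (30 rows:
Boltzmann/Bose/heat-conduction descendants, none on
stacking selection); `lit bridges AtomisticToContinuum --cross any` (30 rows, none relevant); `lit
vsearch "ground states of one-dimensional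
finite-range lattice models are periodic: minimal mean cycle in the de Bruijn graph"` (8 books;
Lavis–Bell, Alicandro–Braides–Cicalese —
no certificate/tail lemma); `lit vsearch "m-potential … Peierls condition …" --books` →
FriedliVelenik2017 pp. 364–366 READ (Lemma 7.13:
finite g_m ⇒ periodic ground states + Peierls condition); `lit galaxy search "Periodicity of
classical ground states" / "minimum mean cycle"
--star all` (Karp's algorithm only in CS volumes; no lattice-gas use found); `lit search --source
crossref` for HolsztynskiSlawny1978
(doi:10.1007/bf01609493) and Contreras2015 (doi:10.1007/s00222-015-0638-0); the card's own searches
(Contreras generic periodicity,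
ANNNI polytype staircases, Radin–Schulman) and the refuter-13 audit (Teubner1990,
Bundaru–Angelescu–Nenciu 1973, Loach–Ackland n ≤ 3
polytope corner); `lit search` FTS daemon unavailable during the session (connection reset), remote
tiers used instead.
Nearest prior art found: Teubner1990 / RadinSchulman1983 (finite range: ground state = minimum mean
cycle of the de Bruijn graph, periodic);
HolsztynskiSlawny1978 + FriedliVelenik2017 Lemma 7.13 (node potentials = equivalent m-potential,
Peierls constant); GlodkowskiMiekisz2024
(instability  [refs: 10.1007/bf01609493, 10.1007/s00222-015-0638-0, doi:10.1007/bf01609493, doi:10.1007/s00222-015-0638-0, FriedliVelenik2017, HolsztynskiSlawny1978, Contreras2015, Teubner1990, RadinSchulman1983, GlodkowskiMiekisz2024]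

Barriers (technique_class: ergodic-optimisation min-mean-cycle hagg-sequence-reduction): - technique_class: ergodic-optimisation min-mean-cycle hagg-sequence-reduction
- Literature.Barriers.AtomisticToContinuum.Hubbard1978_mostHomogeneous: APPLIES in principle — it is
exactly the non-termination mode "no K certifies" (Sturmian ground states of 1-D infinite-range
chains). Evasion: Hubbard/Aubry staircases need an imposed density or chemical potential and convex
repulsive couplings of all ranges at comparable strength; the Hägg functional is unconstrained (zero
pressure, the chain picks its own letter frequencies), of unrestricted sign, with one dominant
coupling and a tail smaller by 10^{2.5}; the narrowed entry (Hubbard1978_mostHomogeneousNarrow,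
evasions (a),(d)) records that the theorem is silent on this functional and that its own lesson is
LOCKING off a null parameter set — which is what the certificate decides; non-termination is
reported, never assumed away.
- Literature.Barriers.AtomisticToContinuum.ShortRangeStackingBlindness: respected — all ranges are
kept (finite K plus a rigorous tail Σ_{k>K}), the potential is never cut below √(8/3); selection
comes precisely from the r⁻⁶ registry tail beyond the second shell.
- Literature.Barriers.AtomisticToContinuum.KissingTwelveDegeneracy: evaded by construction — no
contact-graph or first-shell argument is used for selection; the certificate lives on the registry
chain where the degeneracy among kissing-twelve stackings is lifted by J_k.
- Literature.Barriers.AtomisticToContinuum.HcpNotBravais: irrelevant — the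

Novelty grade: new-combination — ROUTE REVIEW pointer (refuter g2, 2026-08-15): the full review of this route is g0's (refuter-rreview-…-5ec9aa5a-0) — per-item notes + stamps on 3452–3459 at 13:41–13:42Z (12/12 rc0; CertificateLocks + Assembly proved, evidence on 3455/3459; PeierlsKarpStability/LockedPhaseDefectBound verified on pa (refuter refuter-rreview-route-AtomisticToContinu-5ec9aa5a-g2-0, 2026-08-15T14:06:34Z; prior: Teubner1990; RadinSchulman1983; HolsztynskiSlawny1978 doi:10.1007/bf01609493; FriedliVelenik2017 Lemma 7.13; GlodkowskiMiekisz2024; route-AtomisticToContinuum-PoissonBesselStacking (3062/3063/0737/3065 shared or subsumed))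

History (route lifecycle, newest last):
- 2026-08-15T13:43:29Z · CLOSED retired — not-a-thesis: assembly does not conclude the sub-problem Statement (operator:999:1257524)

sub-problem: Crystallization · status: closed(retired) · opened planner-plancard-AtomisticToContinuum-Crystal-717b9dc8-0 2026-08-15T11:18:12Z · rev 0 · ledger route-AtomisticToContinuum-KarpPeierlsStackingLock
GENERATED by the gate from the ledger (D-0016/17). Provers cite these decls: `theorem foo : Summit.AtomisticToContinuum.Crystallization.Theses.KarpPeierlsStackingLock.<Decl> := …` in Summits/AtomisticToContinuum/Crystallization/Theorems/<Name>.lean.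
-/

namespace Summit.AtomisticToContinuum.Crystallization.Theses.KarpPeierlsStackingLock

open scoped BigOperators Topology Manifold Classical MeasureTheory ProbabilityTheory Matrix InnerProductSpace ComplexConjugate ContinuousMap
open Filter Set Function TopologicalSpace MeasureTheory

attribute [summit_statement] _root_.Crystallization

/-- item stmt-AtomisticToContinuum-3452 · target · rank 0 · closed · moot by None · by planner
why it might fail: False iff at some (a,h) ∈ B the LJ registry chain has no periodic minimiser (aperiodic/Sturmian selection): needs a codimension-≥1 coincidence for couplings decaying faster than k⁻³, but J_k are uncertified.
sources: GlodkowskiMiekisz2024, VanenterKoivusaloMiekisz2019, PartayOrtnerCsanyi2017, LoachAckland2017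
[target] for all (a,h) in the box B: Σ_k k|J_k(a,h)| < ∞ for J = barlowCoupling lennardJones a h,
and some periodic Hägg sequence w minimises haggStackingEnergy J over all Hägg sequences (X_lock; =
PeierlsKarpStability + LJLockingCertificate via the glue CertificateLocks, or directly Hägg
domination 0737 + certified J₂). -/
@[route_item "route-AtomisticToContinuum-KarpPeierlsStackingLock"]
def LockedStackingOnBox : Prop :=
  ∀ a h : ℝ, 47 / 50 ≤ a → a ≤ 1 → 39 / 50 * a ≤ h → h ≤ 17 / 20 * a → Summable (fun k : ℕ => (k : ℝ) * |Literature.MathematicalPhysics.StatisticalMechanics.barlowCoupling Literature.MathematicalPhysics.StatisticalMechanics.lennardJones a h k|) ∧ ∃ (w : ℤ → ℤ) (p : ℕ), 0 < p ∧ (∀ i, w (i + p) = w i) ∧ Literature.MathematicalPhysics.StatisticalMechanics.IsHaggSeq w ∧ IsLeast (Set.range fun s : {s : ℤ → ℤ // Literature.MathematicalPhysics.StatisticalMechanics.IsHaggSeq s} => Literature.MathematicalPhysics.StatisticalMechanics.haggStackingEnergy (Literature.MathematicalPhysics.StatisticalMechanics.barlowCoupling Literature.MathematicalPhysics.StatisticalMechanics.lennardJones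 a h) s.1) (Literature.MathematicalPhysics.StatisticalMechanics.haggStackingEnergy (Literature.MathematicalPhysics.StatisticalMechanics.barlowCoupling Literature.MathematicalPhysics.StatisticalMechanics.lennardJones a h) w)

/-- item stmt-AtomisticToContinuum-3062 · crux · rank 2 · open · by planner
why it might fail: Contains local optimality of close packing among ALL lattice+motif configurations (open, BlancLewin2015 §2.3); uniform spacings lose to layer-wise relaxed polytypes unless hcp's margin ≈|J₂|/2 per layer beats relaxation gains (≈1e−8); optimum might leave B.
sources: BlancLewin2015, FlatleyTheil2015, BeterminSamajTravenec2022, Stillinger2001, PartayOrtnerCsanyi2017, stmt-AtomisticToContinuum-3062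
[crux] (R) ENERGETIC LAYERING/REDUCTION (card item (3), the genuinely 3-D content): for every
periodic configuration Q of ℝ³ there are (a,h) ∈ B and a periodic Hägg sequence s such that the
uniform Barlow stacking barlowPeriodicConfiguration a h s has Lennard-Jones energy per particle ≤
that of Q. Intended mechanism (foreseen split): near-optimal periodic Q are twelve-coordinated
stacks of triangular layers (Flyspeck L12 cap + LJ bond counting, as in CrystalKissingRigidity K1/K2
but for PERIODIC Q, no N → ∞ defects), lateral offsets are forced into the deep holes by
AdjacentLayerHoleLocking, and layer-dependent spacings relax to a uniform h by convexity of h ↦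
Φ_N(h) (the registry corrections are ≤ 7.3e−5 with dJ₂/dh ≈ 5e−4 against an O(10) stiffness:
non-uniform relaxation gains ≲ 1e−8 per layer). [deps: AdjacentLayerHoleLocking] [difficulty: XL] -/
@[route_item "route-AtomisticToContinuum-KarpPeierlsStackingLock"]
def PeriodicReductionToBarlow : Prop :=
  ∀ Q : Literature.MathematicalPhysics.StatisticalMechanics.PeriodicConfiguration 3, ∃ a h : ℝ, 47 / 50 ≤ a ∧ a ≤ 1 ∧ 39 / 50 * a ≤ h ∧ h ≤ 17 / 20 * a ∧ ∃ (s : ℤ → ℤ) (p : ℕ) (ha : a ≠ 0) (hh : h ≠ 0) (hp : p ≠ 0) (hs : ∀ i, s (i + p) = s i), Literature.MathematicalPhysics.StatisticalMechanics.IsHaggSeq s ∧ (Literature.MathematicalPhysics.StatisticalMechanics.barlowPeriodicConfiguration s ha hh hp hs).energyPerParticle Literature.MathematicalPhysics.StatisticalMechanics.lennardJones ≤ Q.energyPerParticle Literature.MathematicalPhysics.StatisticalMechanics.lennardJones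

/-- item stmt-AtomisticToContinuum-3453 · crux · rank 3 · closed · moot by None · by planner
why it might fail: Needs interval-certified 2-D lattice sums J_k(a,h) uniformly on B plus a tail bound (no such infrastructure in tree); fails if J₂ changes sign on B or no finite K locks (Hubbard-type aperiodic selection); K=2 witness rests on uncertified J₂≈−7.3e-5.
sources: PartayOrtnerCsanyi2017, LoachAckland2017, Stillinger2001, stmt-AtomisticToContinuum-0670, Literature.Barriers.AtomisticToContinuum.Hubbard1978_mostHomogeneous
[crux] CERTIFIED LOCKING CERTIFICATE for Lennard-Jones on the box: there are a window length K = L+1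
and a set E of Hägg K-words forming node-disjoint simple cycles of the de Bruijn graph
(out/in-degree ≤ 1 on E, every E-word continues in E) such that for every (a,h) ∈ B, with J =
barlowCoupling lennardJones a h: Σ k|J_k| < ∞ and there are node potentials u on (K−1)-words, a
value λ and a gap g with slack(x) := Σ_{k=2}^{K} J_k·1[x₀+…+x_{k−1} ≡ 0 (3)] − λ + u(prefix x) −
u(suffix x) = 0 on E, ≥ g on every other Hägg K-word, and g ≥ 2Σ_{k>K}(k+|E|+1)|J_k|. Expected
witness (card S3, Hägg domination): L = 1, E = {(+,−),(−,+)}, u ≡ 0, λ = J₂ < 0, g = −J₂ ≈ 7e−5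
against a tail ≈ 1e−6 (ratio 250–600); certified by interval arithmetic for the 2-D layer sums
(Poisson/Bessel form converges exponentially) with a rigorous tail bound, uniformly on B.
[difficulty: L] -/
@[route_item "route-AtomisticToContinuum-KarpPeierlsStackingLock"]
def LJLockingCertificate : Prop :=
  ∃ (L : ℕ) (E : Finset (Fin (L + 1) → ℤ)), E.Nonempty ∧ (∀ x ∈ E, ∀ y ∈ E, (fun i : Fin L => x (Fin.castSucc i)) = (fun i : Fin L => y (Fin.castSucc i)) → x = y) ∧ (∀ x ∈ E, ∀ y ∈ E, (fun i : Fin L => x (Fin.succ i)) = (fun i : Fin L => y (Fin.succ i)) → x = y) ∧ (∀ x ∈ E, ∃ y ∈ E, (fun i : Fin L => y (Fin.castSucc i)) = (fun i : Fin L => x (Fin.succ i))) ∧ ∀ a h : ℝ, 47 / 50 ≤ a → a ≤ 1 → 39 / 50 * a ≤ h → h ≤ 17 / 20 * a → let J : ℕ → ℝ := Literature.MathematicalPhysics.StatisticalMechanics.barlowCoupling Literature.MathematicalPhysics.StatisticalMechanics.lennardJones a h; Summable (fun k : ℕ => (k : ℝ) * |J k|) ∧ ∃ (u : (Fin L → ℤ)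 → ℝ) (lam g : ℝ), (∀ x ∈ E, (∀ i, x i = 1 ∨ x i = -1) ∧ (∑ k ∈ Finset.Icc 2 (L + 1), if (∑ i : Fin (L + 1), if (i : ℕ) < k then x i else 0) % 3 = 0 then J k else 0) - lam + u (fun i : Fin L => x (Fin.castSucc i)) - u (fun i : Fin L => x (Fin.succ i)) = 0) ∧ (∀ x : Fin (L + 1) → ℤ, (∀ i, x i = 1 ∨ x i = -1) → x ∉ E → g ≤ (∑ k ∈ Finset.Icc 2 (L + 1), if (∑ i : Fin (L + 1), if (i : ℕ) < k then x i else 0) % 3 = 0 then J k else 0) - lam + u (fun i : Fin L => x (Fin.castSucc i)) - u (fun i : Fin L => x (Fin.succ i))) ∧ 2 * (∑' k : ℕ, if L + 1 < k then ((k : ℝ) + E.card + 1) * |J k| else 0) ≤ g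

/-- item stmt-AtomisticToContinuum-3454 · crux · rank 4 · closed · moot by None · by planner
why it might fail: Only by bookkeeping: the tail constant 2Σ_{k>K}(k+|E|+1)|J_k|, windows poking beyond n, liminf junk values, or a missing structural clause on E; brute force (K≤3: hcp, dhcp, fcc locks; periods ≤10; near-threshold tails) found 0 violations.
sources: RadinSchulman1983, Teubner1990, HolsztynskiSlawny1978, FriedliVelenik2017, GlodkowskiMiekisz2024, stmt-AtomisticToContinuum-0737
[crux] PEIERLS–KARP STABILITY LEMMA (card S1; pure 1-D lattice-gas theorem over HaggStacking.lean,
no LJ input): for couplings J with Σ k|J_k| < ∞, a window length K = L+1, a nonempty set E of Hägg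
K-words with out-degree ≤ 1, in-degree ≤ 1 and continuation inside E (so E is a disjoint union of
simple cycles with pairwise distinct (K−1)-nodes), potentials u, value λ and gap g such that the
slack Σ_{k=2}^{K} J_k 1[x₀+…+x_{k−1} ≡ 0 (3)] − λ + u(prefix x) − u(suffix x) vanishes on E and is ≥
g on every other Hägg K-word, and g ≥ 2·Σ_{k>K}(k+|E|+1)|J_k|: SOME periodic sequence w all of whose
K-windows lie in E (an E-cycle read off letter by letter) minimises haggStackingEnergy J over all
Hägg sequences. Proof sketch: telescoping the potentials gives H_n^K(s) ≥ nλ − osc(u) + g·b_n (b_n =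
# bad windows in [0,n)); good stretches follow E-cycles by the degree conditions; the tail k > K
differs from the cycles' tail densities by ≤ (b_n+1)Σ_{k>K}(k+|E|+1)|J_k|; choose the E-cycle of
least full density. K = 2, E = {+−,−+}, u ≡ 0 is Hägg domination (0737) with a cruder constant.
[difficulty: M] -/
@[route_item "route-AtomisticToContinuum-KarpPeierlsStackingLock"]
def PeierlsKarpStability : Prop :=
  ∀ (J : ℕ → ℝ) (L : ℕ) (E : Finset (Fin (L + 1) → ℤ)) (u : (Fin L → ℤ) → ℝ) (lam g : ℝ), Summable (fun k : ℕ => (k : ℝ) * |J k|) → E.Nonempty → (∀ x ∈ E, ∀ y ∈ E, (fun i : Fin L => x (Fin.castSucc i)) = (fun i : Fin L => y (Fin.castSucc i)) → x = y) → (∀ x ∈ E, ∀ y ∈ E, (fun i : Fin L => x (Fin.succ i)) = (fun i : Fin L => y (Fin.succ i)) → x = y) → (∀ x ∈ E, ∃ y ∈ E, (fun i : Fin L => y (Fin.castSucc i)) = (fun i : Fin L => x (Fin.succ i))) → (∀ x ∈ E, (∀ i, x i = 1 ∨ x i = -1) ∧ (∑ k ∈ Finset.Icc 2 (L + 1), if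 (∑ i : Fin (L + 1), if (i : ℕ) < k then x i else 0) % 3 = 0 then J k else 0) - lam + u (fun i : Fin L => x (Fin.castSucc i)) - u (fun i : Fin L => x (Fin.succ i)) = 0) → (∀ x : Fin (L + 1) → ℤ, (∀ i, x i = 1 ∨ x i = -1) → x ∉ E → g ≤ (∑ k ∈ Finset.Icc 2 (L + 1), if (∑ i : Fin (L + 1), if (i : ℕ) < k then x i else 0) % 3 = 0 then J k else 0) - lam + u (fun i : Fin L => x (Fin.castSucc i)) - u (fun i : Fin L => x (Fin.succ i))) → 2 * (∑' k : ℕ, if L + 1 < k then ((k : ℝ) + E.card + 1) * |J k| else 0) ≤ g → ∃ (w : ℤ → ℤ) (p : ℕ), 0 < p ∧ (∀ i, w (i + p) = w i) ∧ (∀ m : ℤ, (fun i : Fin (L + 1) => w (m + ((i : ℕ) : ℤ))) ∈ E) ∧ IsLeast (Set.range fun s : {s : ℤ → ℤ // Literature.MathematicalPhysics.StatisticalMechanics.IsHaggSeq s} => Literature.MathematicalPhysics.StatisticalMechanics.haggStackingEnergy J s.1) (Literature.MathematicalPhysics.StatisticalMechanics.haggStackingEnergy J w)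

/-- item stmt-AtomisticToContinuum-0625 · crux · rank 5 · open · by planner
why it might fail: Conjunct (ii) itself: rigidity for a PAIR potential in 3-D without Flatley–Theil's three-body term is open; persistent polytetrahedral/icosahedral order in LJ ground states would refute it and every stacking route with it.
sources: BlancLewin2015, FlatleyTheil2015, Theil2006, stmt-AtomisticToContinuum-0625
Blanc–Lewin positional crystallization for Lennard-Jones in ℝ³ (conjunct (ii) itself): the route's
content is (a) local optimality + (b) rigidity for a PAIR potential in 3-D without Flatley–Theil's
auxiliary three-body term (arXiv:1407.0692 Thm 1.1, p.4) + (c) periodic optimal stacking ⇒ every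
vague limit of translated ground states along a subsequence is a non-zero window of a periodic
optimal stacking. -/
@[route_item "route-AtomisticToContinuum-KarpPeierlsStackingLock"]
def CrysPositional : Prop :=
  Literature.MathematicalPhysics.StatisticalMechanics.IsCrystallizing Literature.MathematicalPhysics.StatisticalMechanics.lennardJones 3

/-- item stmt-AtomisticToContinuum-0626 · support · rank 9 · closed · proved by Summit.AtomisticToContinuum.Crystallization.Theorems.crysEnergyLimit_proof @ de27d46e58f4 (prover) · by planner
sources: BlancLewin2015, stmt-AtomisticToContinuum-0626
Energetic crystallization: E(N)/N converges to the infimum over periodic (multi-lattice)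
configurations of the LJ energy per particle in d = 3. Lower bound liminf ≥ ⨅ is the content ((a)
local optimality + (d) + surface term O(N^{2/3})); upper bound is filed separately. -/
@[route_item "route-AtomisticToContinuum-KarpPeierlsStackingLock"]
def CrysEnergyLimit : Prop :=
  Filter.Tendsto (fun N : ℕ => Literature.MathematicalPhysics.StatisticalMechanics.groundStateEnergy Literature.MathematicalPhysics.StatisticalMechanics.lennardJones 3 N / N) Filter.atTop (nhds (⨅ Q : Literature.MathematicalPhysics.StatisticalMechanics.PeriodicConfiguration 3, Q.energyPerParticle Literature.MathematicalPhysics.StatisticalMechanics.lennardJones))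

/-- `CrysEnergyLimit` holds: proved by `Summit.AtomisticToContinuum.Crystallization.Theorems.crysEnergyLimit_proof` @ de27d46e58f4. -/
theorem CrysEnergyLimit_holds : CrysEnergyLimit := _root_.Summit.AtomisticToContinuum.Crystallization.Theorems.crysEnergyLimit_proof

/-- item stmt-AtomisticToContinuum-3065 · support · rank 9 · closed · proved by Summit.AtomisticToContinuum.Crystallization.Theorems.PricedHcpWindowsBarlowEnergy.stub_barlowEnergyIdentification @ bf3f020dee6e (prover) · by planner
sources: BlancLewin2015, PartayOrtnerCsanyi2017, stmt-AtomisticToContinuum-3065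
[support] the regrouping left open in BarlowStackingEnergy.lean ('Not proved here'): for a, h > 0
and a p-periodic Hägg sequence s, the energy per particle (Crystallization.lean, tsum over the point
set) of barlowPeriodicConfiguration a h s equals barlowBaseEnergy lennardJones a h + haggEnergy p
(barlowCoupling lennardJones a h) s / p (absolute summability of the LJ lattice sum,
PeriodicConfigurationSums.lean, + barlowSiteEnergy_average_eq_haggEnergy + motif card = p).
[difficulty: provable-now] -/
@[route_item "route-AtomisticToContinuum-KarpPeierlsStackingLock"]
def BarlowEnergyIdentification : Prop :=
  ∀ a h : ℝ, 0 < a → 0 < h → ∀ (s : ℤ → ℤ) (p : ℕ) (ha : a ≠ 0) (hh : h ≠ 0) (hp : p ≠ 0) (hs : ∀ i, s (i + p) = s i), Literature.MathematicalPhysics.StatisticalMechanics.IsHaggSeq s → (Literature.MathematicalPhysics.StatisticalMechanics.barlowPeriodicConfiguration s ha hh hp hs).energyPerParticle Literature.MathematicalPhysics.StatisticalMechanics.lennardJones = Literature.MathematicalPhysics.StatisticalMechanics.barlowBaseEnergy Literature.MathematicalPhysics.StatisticalMechanics.lennardJones a h + Literature.MathematicalPhysics.StatisticalMechanics.haggEnergy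 p (Literature.MathematicalPhysics.StatisticalMechanics.barlowCoupling Literature.MathematicalPhysics.StatisticalMechanics.lennardJones a h) s / p

/-- `BarlowEnergyIdentification` holds: proved by `Summit.AtomisticToContinuum.Crystallization.Theorems.PricedHcpWindowsBarlowEnergy.stub_barlowEnergyIdentification` @ bf3f020dee6e. -/
theorem BarlowEnergyIdentification_holds : BarlowEnergyIdentification := _root_.Summit.AtomisticToContinuum.Crystallization.Theorems.PricedHcpWindowsBarlowEnergy.stub_barlowEnergyIdentification

/-- item stmt-AtomisticToContinuum-3455 · support · rank 9 · closed · moot by None · by planner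
sources: RadinSchulman1983
[support] glue of the target: the stability lemma instantiated with the LJ certificate gives
LockedStackingOnBox (pure instantiation; E-words are Hägg words, so the E-periodic minimiser is a
Hägg sequence). [difficulty: provable-now] -/
@[route_item "route-AtomisticToContinuum-KarpPeierlsStackingLock"]
def CertificateLocks : Prop :=
  PeierlsKarpStability → LJLockingCertificate → LockedStackingOnBox

/-- item stmt-AtomisticToContinuum-3456 · support · rank 9 · closed · moot by None · by planner
sources: PartayOrtnerCsanyi2017
[support] for summable J and a p-periodic sequence s (p > 0) the stacking energy density
haggStackingEnergy J s (a liminf of H_n/n) equals the per-period average haggEnergy p J s / p (local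
energies are p-periodic in the base point, H_{qp+r} = q·H_p + O(p·Σ|J_k|)). [difficulty:
provable-now] -/
@[route_item "route-AtomisticToContinuum-KarpPeierlsStackingLock"]
def HaggEnergyPeriodic : Prop :=
  ∀ (J : ℕ → ℝ) (s : ℤ → ℤ) (p : ℕ), Summable J → 0 < p → (∀ i, s (i + p) = s i) → Literature.MathematicalPhysics.StatisticalMechanics.haggStackingEnergy J s = Literature.MathematicalPhysics.StatisticalMechanics.haggEnergy p J s / p

/-- item stmt-AtomisticToContinuum-3457 · support · rank 9 · closed · moot by None · by planner
sources: BlancLewin2015, BeterminSamajTravenec2022, stmt-AtomisticToContinuum-0627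
[support] ANALYSIS GLUE to the attained periodic minimum (0627): LockedStackingOnBox →
PeriodicReductionToBarlow → BarlowEnergyIdentification → HaggEnergyPeriodic → ∃ P periodic, IsLeast
(range e_LJ) (e P). Proof: φ(a,h) := e₀(a,h) + min_s haggStackingEnergy(J(a,h), s) is continuous on
the compact box B (e₀ and (a,h) ↦ (J_k(a,h))_k ∈ ℓ¹ depend continuously on (a,h) by uniform
convergence of the LJ layer sums on B; an infimum of an equicontinuous affine family is continuous),
so it is attained at some (a₀,h₀); P := barlowPeriodicConfiguration w_{a₀,h₀}; for any Q the
reduction gives a box stacking s_Q at (a,h) with e(Q) ≥ e(s_Q) = e₀(a,h) + haggStackingEnergy(s_Q) ≥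
φ(a,h) ≥ φ(a₀,h₀) = e(P). [difficulty: M] -/
@[route_item "route-AtomisticToContinuum-KarpPeierlsStackingLock"]
def LockedBoxMinimiser : Prop :=
  LockedStackingOnBox → PeriodicReductionToBarlow → BarlowEnergyIdentification → HaggEnergyPeriodic → ∃ P : Literature.MathematicalPhysics.StatisticalMechanics.PeriodicConfiguration 3, IsLeast (Set.range fun Q : Literature.MathematicalPhysics.StatisticalMechanics.PeriodicConfiguration 3 => Q.energyPerParticle Literature.MathematicalPhysics.StatisticalMechanics.lennardJones) (P.energyPerParticle Literature.MathematicalPhysics.StatisticalMechanics.lennardJones)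

/-- item stmt-AtomisticToContinuum-3458 · support · rank 9 · closed · moot by None · by planner
sources: HolsztynskiSlawny1978, FriedliVelenik2017, stmt-AtomisticToContinuum-0759
[support] QUANTITATIVE LOCKING (the Peierls inequality behind the lemma, for the positional side):
under the hypotheses of PeierlsKarpStability there are an E-periodic w and a constant C such that
for every Hägg sequence s and every n: (g − 2Σ_{k>K}(k+|E|+1)|J_k|)·#{m < n : the K-window of s at m
is not in E} ≤ haggEnergy n J s − n·haggStackingEnergy J w + C (C = tail + osc(u)). Hence a stacking
whose registry energy exceeds the minimum by Δ carries ≤ (Δ + C)/(g − 2·tail) misaligned windows —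
the per-fault price that fault-counting statements (0759) assume. [difficulty: M] -/
@[route_item "route-AtomisticToContinuum-KarpPeierlsStackingLock"]
def LockedPhaseDefectBound : Prop :=
  ∀ (J : ℕ → ℝ) (L : ℕ) (E : Finset (Fin (L + 1) → ℤ)) (u : (Fin L → ℤ) → ℝ) (lam g : ℝ), Summable (fun k : ℕ => (k : ℝ) * |J k|) → E.Nonempty → (∀ x ∈ E, ∀ y ∈ E, (fun i : Fin L => x (Fin.castSucc i)) = (fun i : Fin L => y (Fin.castSucc i)) → x = y) → (∀ x ∈ E, ∀ y ∈ E, (fun i : Fin L => x (Fin.succ i)) = (fun i : Fin L => y (Fin.succ i)) → x = y) → (∀ x ∈ E, ∃ y ∈ E, (fun i : Fin L => y (Fin.castSucc i)) = (fun i : Fin L => x (Fin.succ i))) → (∀ x ∈ E, (∀ i, x i = 1 ∨ x i = -1) ∧ (∑ k ∈ Finset.Icc 2 (L + 1), if (∑ i : Fin (L + 1), if (i : ℕ) < k then x i else 0) % 3 = 0 then J k else 0) - lam + u (fun i : Fin L => x (Fin.castSucc i)) - u (fun i : Fin L => x (Fin.succ i)) = 0) → (∀ x : Fin (L + 1) →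 ℤ, (∀ i, x i = 1 ∨ x i = -1) → x ∉ E → g ≤ (∑ k ∈ Finset.Icc 2 (L + 1), if (∑ i : Fin (L + 1), if (i : ℕ) < k then x i else 0) % 3 = 0 then J k else 0) - lam + u (fun i : Fin L => x (Fin.castSucc i)) - u (fun i : Fin L => x (Fin.succ i))) → 2 * (∑' k : ℕ, if L + 1 < k then ((k : ℝ) + E.card + 1) * |J k| else 0) ≤ g → ∃ (w : ℤ → ℤ) (p : ℕ) (C : ℝ), 0 < p ∧ (∀ i, w (i + p) = w i) ∧ (∀ m : ℤ, (fun i : Fin (L + 1) => w (m + ((i : ℕ) : ℤ))) ∈ E) ∧ ∀ (s : ℤ → ℤ) (n : ℕ), Literature.MathematicalPhysics.StatisticalMechanics.IsHaggSeq s → (g - 2 * (∑' k : ℕ, if L + 1 < k then ((k : ℝ) + E.card + 1) * |J k| else 0)) * (((Finset.range n).filter (fun m : ℕ => (fun i : Fin (L + 1) => s ((m : ℤ) + ((i : ℕ) : ℤ))) ∉ E)).card : ℝ) ≤ Literature.MathematicalPhysics.StatisticalMechanics.haggEnergy n J s - (n : ℝ) * Literature.MathematicalPhysics.StatisticalMechanics.haggStackingEnergy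 J w + C

/-- item stmt-AtomisticToContinuum-3459 · assembly · rank 1 · closed · moot by None · by planner
sources: BlancLewin2015
[assembly] LockedBoxMinimiser → LockedStackingOnBox → PeriodicReductionToBarlow →
BarlowEnergyIdentification → HaggEnergyPeriodic → CrysEnergyLimit → CrysPositional →
Crystallization. -/
@[route_item "route-AtomisticToContinuum-KarpPeierlsStackingLock"]
def Assembly : Prop :=
  LockedBoxMinimiser → LockedStackingOnBox → PeriodicReductionToBarlow → BarlowEnergyIdentification → HaggEnergyPeriodic → CrysEnergyLimit → CrysPositional → Literature.MathematicalPhysics.StatisticalMechanics.Crystallization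

end Summit.AtomisticToContinuum.Crystallization.Theses.KarpPeierlsStackingLock
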